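import Summits.ResolutionOfSingularities.ResolutionOfSingularities.Theorems.PurelyInseparableDim4SwapTransportWindowFrame
import HarnessLib
import HarnessLib.Audit.Tags

/-!
# Purely inseparable four-folds — THE REGIME-FREE TRANSPORT CORE of the virtual window: one real step (slot step or rotation)
# shadowed through the slot-unit class ℛ², for ANY polar-kernel rank `e_G`, with the virtual translation RETURNED
# (cell `res-dim4-pi`, K2(p) lane; service file for the re-presentation sockets hN4-C′ / hN4-D)

[OURS · counted 0 · cell `res-dim4-pi` · res-dim4-typ-1 g3.]  Nothing here proves K2(p)/K2(5), `NoIsolatedTrap 5 5` or resolution of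
singularities in dimension ≥ 4 / characteristic `p` — NOT proved.  AI kernel work, weaker than expert review.

`virtual_core_slot` / `virtual_core_rotate` = steps (1)–(7) of `virtual_step_slot` / `virtual_step_rotate` (…WindowStep) with
the C∞ frame REMOVED and `e_G = 3` replaced by any value `eG`: kept slot / rotation shape from the weights, Cramer translation
`b′` (off the slots), `unitFrame_step₂` / `unitFrame_rotate₂`, determinant bookkeeping, `read_of_rel₂` (order 6 and isolation of
the translated virtual child `step 5 univ ℓ b′ B`), ledger and `x^r ∣ F` of the child, `e_G` by value.  What a regime must add
to obtain a PURE virtual step is only the pinning `b′ = 0` (for the C∞ regime: `translation_eq_zero_of_frame`).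
bears_on: LADDER-RESOLUTION:D157-DOOR2 (res-dim4-pi · K2(p) · re-presentation sockets).  Supports stmt-ResolutionOfSingularities-16155
(helper).
-/

set_option linter.dupNamespace false -- mandated namespace of this single-conjunct summit

noncomputable section

namespace Summit.ResolutionOfSingularities.ResolutionOfSingularities.Theorems.PIDim4

namespace SwapTransport

open MvPolynomial Finset
open Literature.AlgebraicGeometry.Resolution
open Literature.AlgebraicGeometry.Resolution.CentreBlowup
open Literature.AlgebraicGeometry.Resolution.Hauser2010
open Literature.AlgebraicGeometry.Resolution.HauserPerlega2019

variable {K : Type} [Field K] [CharP K 5] [DecidableEq K]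

/-! ## §1 Slot case -/

/-- **TRANSPORT CORE — SLOT CASE** (regime-free: any `e_G`; no frame; the virtual translation `b′` is RETURNED, supported on
the free letters; a regime-specific pinning lemma then shows `b′ = 0`). [OURS] [cite: Hauser2010, §§F–G]
[cite: CossartJannsenSaito2020, Thm. 3.14] -/
theorem virtual_core_slot {π : Equiv.Perm (Fin 4)} {la mu u f : Fin 4} (hlm : la ≠ mu) (hlu : la ≠ u) (hlf : la ≠ f)
    (hmu : mu ≠ u) (hmf : mu ≠ f) (huf : u ≠ f)
    -- the relation at precision `M`
    {A B : State K} {θ e : Fin 4 → MvPolynomial (Fin 4) K} {U E : MvPolynomial (Fin 4) K} {M : ℕ}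
    (hθa : θ (π la) = X la * e la) (hθa' : θ (π mu) = X mu * e mu) (hea : constantCoeff (e la) ≠ 0)
    (hea' : constantCoeff (e mu) ≠ 0) (hu0 : constantCoeff (θ (π u)) = 0) (hf0 : constantCoeff (θ (π f)) = 0)
    (hdet : coeff (Finsupp.single u 1) (θ (π u)) * coeff (Finsupp.single f 1) (θ (π f)) -
      coeff (Finsupp.single f 1) (θ (π u)) * coeff (Finsupp.single u 1) (θ (π f)) ≠ 0)
    (hU : constantCoeff U ≠ 0) (hE : E ∈ originIdeal K ^ M) (hrel : B.F = deletePthPowers 5 (U ^ 5 * aeval θ A.F) + E)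
    -- the real state and its honest slot step
    (hoA : ordZero A.F = 6) (hrA : A.r = Finsupp.single (π la) 1 + Finsupp.single (π mu) 1) {A' : State K}
    {b : Fin 4 → K} (hbj : b (π la) = 0) (hstep : A' = CentreBlowup.step 5 Finset.univ (π la) b A)
    (hisoA' : IsIsolated 5 A'.F) {Nc : ℕ} (hcert : originIdeal K ^ Nc ≤ singLocusIdeal 5 A'.F ⊔ originIdeal K ^ (Nc + 1))
    (hoA' : ordZero A'.F = 6) {eG : ℕ} (he3A' : Module.finrank K (ResCone.resVertex A') = eG) (hw1 : ∀ i, A'.r i ≤ 1)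
    (hdegA' : A'.r.degree = 2) (hdivA' : ∀ d ∈ A'.F.support, A'.r ≤ d)
    -- the virtual frame at jet `N`
    (hoB : ordZero B.F = 6) (hrB : B.r = Finsupp.single la 1 + Finsupp.single mu 1) (hdivB : ∀ d ∈ B.F.support, B.r ≤ d)
    (hM : Nc + 12 ≤ M)
    -- `e_G` through the relation, BY VALUE (res-dim4-p-7 g4)
    (hEG : ∀ (A₁ B₁ : State K) (θ₁ e₁ : Fin 4 → MvPolynomial (Fin 4) K) (U₁ E₁ : MvPolynomial (Fin 4) K) (M₁ : ℕ),
      θ₁ (π la) = X la * e₁ la → θ₁ (π mu) = X mu * e₁ mu → constantCoeff (e₁ la) ≠ 0 → constantCoeff (e₁ mu) ≠ 0 →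
      constantCoeff (θ₁ (π u)) = 0 → constantCoeff (θ₁ (π f)) = 0 →
      coeff (Finsupp.single u 1) (θ₁ (π u)) * coeff (Finsupp.single f 1) (θ₁ (π f)) -
        coeff (Finsupp.single f 1) (θ₁ (π u)) * coeff (Finsupp.single u 1) (θ₁ (π f)) ≠ 0 →
      constantCoeff U₁ ≠ 0 → E₁ ∈ originIdeal K ^ M₁ → B₁.F = deletePthPowers 5 (U₁ ^ 5 * aeval θ₁ A₁.F) + E₁ →
      A₁.r = Finsupp.single (π la) 1 + Finsupp.single (π mu) 1 → B₁.r = Finsupp.single la 1 + Finsupp.single mu 1 →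
      (∀ d ∈ A₁.F.support, A₁.r ≤ d) → (∀ d ∈ B₁.F.support, B₁.r ≤ d) → ordZero A₁.F = 6 → ordZero B₁.F = 6 → 6 < M₁ →
      Module.finrank K (ResCone.resVertex B₁) = Module.finrank K (ResCone.resVertex A₁)) :
    b (π mu) = 0 ∧ A'.r = Finsupp.single (π la) 1 + Finsupp.single (π mu) 1 ∧
    ∃ (b' : Fin 4 → K) (θ' e' : Fin 4 → MvPolynomial (Fin 4) K) (U' E' : MvPolynomial (Fin 4) K),
      b' la = 0 ∧ b' mu = 0 ∧
      θ' (π la) = X la * e' la ∧ θ' (π mu) = X mu * e' mu ∧ constantCoeff (e' la) ≠ 0 ∧ constantCoeff (e' mu) ≠ 0 ∧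
      constantCoeff (θ' (π u)) = 0 ∧ constantCoeff (θ' (π f)) = 0 ∧
      coeff (Finsupp.single u 1) (θ' (π u)) * coeff (Finsupp.single f 1) (θ' (π f)) -
        coeff (Finsupp.single f 1) (θ' (π u)) * coeff (Finsupp.single u 1) (θ' (π f)) ≠ 0 ∧
      constantCoeff U' ≠ 0 ∧ E' ∈ originIdeal K ^ (M - 5) ∧
      (CentreBlowup.step 5 Finset.univ la b' B).F = deletePthPowers 5 (U' ^ 5 * aeval θ' A'.F) + E' ∧
      ordZero (CentreBlowup.step 5 Finset.univ la b' B).F = 6 ∧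
      (CentreBlowup.step 5 Finset.univ la b' B).r = Finsupp.single la 1 + Finsupp.single mu 1 ∧
      (∀ d ∈ (CentreBlowup.step 5 Finset.univ la b' B).F.support, (CentreBlowup.step 5 Finset.univ la b' B).r ≤ d) ∧
      IsIsolated 5 (CentreBlowup.step 5 Finset.univ la b' B).F ∧
      Module.finrank K (ResCone.resVertex (CentreBlowup.step 5 Finset.univ la b' B)) = eG := by
  haveI : Fact (Nat.Prime 5) := ⟨by norm_num⟩
  have hπlm : π la ≠ π mu := fun h => hlm (π.injective h)
  have hπlu : π la ≠ π u := fun h => hlu (π.injective h)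
  have hπlf : π la ≠ π f := fun h => hlf (π.injective h)
  have hπmu : π mu ≠ π u := fun h => hmu (π.injective h)
  have hπmf : π mu ≠ π f := fun h => hmf (π.injective h)
  have hπuf : π u ≠ π f := fun h => huf (π.injective h)
  -- (1) the kept slot: `b (π mu) = 0`, `A′.r = x_{πλ} x_{πμ}`
  have hw1' : ∀ i, (CentreBlowup.step 5 Finset.univ (π la) b A).r i ≤ 1 := fun i => by rw [← hstep]; exact hw1 i
  have hdeg' : (CentreBlowup.step 5 Finset.univ (π la) b A).r.degree = 2 := by rw [← hstep]; exact hdegA'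
  have hkept : b (π mu) = 0 ∧ A'.r = Finsupp.single (π la) 1 + Finsupp.single (π mu) 1 := by
    rcases step_cases_of_weights hπlm hπlu hπlf hπmu hπmf hπuf hrA hoA (jr := π la) hw1' hdeg' with
      ⟨-, hb, hr⟩ | ⟨h, -⟩ | ⟨h, -⟩
    · exact ⟨hb, by rw [hstep, hr]⟩
    · exact absurd h hπlm
    · rcases h with h | h
      · exact absurd h hπlu
      · exact absurd h hπlf
  obtain ⟨hbmu, hrA'⟩ := hkept
  -- (2) the class hypotheses in `∀ i ∉ {u, f}` form
  have hslots : ∀ i : Fin 4, i ≠ u → i ≠ f → i = la ∨ i = mu := by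
    intro i hiu hif
    rcases ResCone.letters_exhaust hlm hlu hlf hmu hmf huf i with h | h | h | h
    · exact Or.inl h
    · exact Or.inr h
    · exact absurd h hiu
    · exact absurd h hif
  have hθi : ∀ i, i ≠ u → i ≠ f → θ (π i) = X i * e i := by
    intro i hiu hif; rcases hslots i hiu hif with rfl | rfl <;> assumption
  have he : ∀ i, i ≠ u → i ≠ f → constantCoeff (e i) ≠ 0 := by
    intro i hiu hif; rcases hslots i hiu hif with rfl | rfl <;> assumption
  have hbi : ∀ i, i ≠ u → i ≠ f → b (π i) = 0 := by
    intro i hiu hif; rcases hslots i hiu hif with rfl | rfl <;> assumption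
  -- (3) Cramer: the virtual translation
  obtain ⟨b', hb'i, hγu, hγf⟩ := exists_virtual_translation_step (π := π) (θ := θ) (e := e) la huf b hdet
  have hA5 : ((5 : ℕ) : ℕ∞) ≤ ordAlong Finset.univ A.F := by rw [ordAlong_univ, hoA]; exact_mod_cast (by norm_num : 5 ≤ 6)
  have hB5 : ((5 : ℕ) : ℕ∞) ≤ ordAlong Finset.univ B.F := by rw [ordAlong_univ, hoB]; exact_mod_cast (by norm_num : 5 ≤ 6)
  -- (4) transport
  obtain ⟨θ', e', U', E', w, hθ'i, he', hu0', hf0', hU', hE', hrel', hwc, -, -, hlinu, hlinf⟩ :=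
    unitFrame_step₂ 5 π huf hθi he hu0 hf0 hU hE hrel hA5 hB5 hlu hlf hbi hb'i hγu hγf
  rw [← hstep] at hrel'
  have hwne : w ≠ 0 := left_ne_zero_of_mul_eq_one hwc
  -- (5) the new free block is invertible
  have hdet' : coeff (Finsupp.single u 1) (θ' (π u)) * coeff (Finsupp.single f 1) (θ' (π f)) -
      coeff (Finsupp.single f 1) (θ' (π u)) * coeff (Finsupp.single u 1) (θ' (π f)) ≠ 0 := by
    rw [det_after_step hlu hlf hlinu hlinf]
    exact mul_ne_zero (pow_ne_zero 2 hwne) hdet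
  -- (6) order and isolation of the virtual child
  set Bp := CentreBlowup.step 5 Finset.univ la b' B with hBp
  have hread := read_of_rel₂ 5 hlm hlu hlf hmu hmf huf (hθ'i la hlu hlf) (hθ'i mu hmu hmf) (he' la hlu hlf)
    (he' mu hmu hmf) hu0' hf0' hdet' hU' hE' hrel' hisoA' hcert (by omega) (o := 6) hoA' (by norm_num) (by omega)
  have hisoBp : IsIsolated 5 Bp.F := hread.1
  have hoBp : ordZero Bp.F = 6 := by exact_mod_cast hread.2
  -- (7) ledger and divisibility of the virtual child, then `e_G` by value
  have hb'la : b' la = 0 := hb'i la hlu hlf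
  have hb'mu : b' mu = 0 := hb'i mu hmu hmf
  have hrBp : Bp.r = Finsupp.single la 1 + Finsupp.single mu 1 := by
    obtain ⟨-, h2, h3, h4⟩ := ResCone.quad_apply hlm hlu hlf hmu hmf huf 1 1 0 0
    have hrB4 : B.r = Finsupp.single la 1 + Finsupp.single mu 1 + Finsupp.single u 0 + Finsupp.single f 0 := by
      rw [hrB, Finsupp.single_zero, Finsupp.single_zero, add_zero, add_zero]
    rw [ResCone.eq_sum_single_four hlm hlu hlf hmu hmf huf Bp.r, hBp, step_r_apply_six hoB, step_r_apply_six hoB,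
      step_r_apply_six hoB, step_r_apply_six hoB, if_pos rfl, if_neg hlm.symm, if_pos hb'mu, if_neg (Ne.symm hlu),
      if_neg (Ne.symm hlf), hrB4, h2, h3, h4, ite_self, ite_self, Finsupp.single_zero, Finsupp.single_zero, add_zero, add_zero]
  have hdivBp : ∀ d ∈ Bp.F.support, Bp.r ≤ d := forall_le_step_six hoB hdivB la hb'la
  have he3Bp : Module.finrank K (ResCone.resVertex Bp) = eG := by
    rw [hEG A' Bp θ' e' U' E' (M - 5) (hθ'i la hlu hlf) (hθ'i mu hmu hmf) (he' la hlu hlf) (he' mu hmu hmf) hu0' hf0'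
      hdet' hU' hE' hrel' hrA' hrBp hdivA' hdivBp hoA' hoBp (by omega)]
    exact he3A'
  exact ⟨hbmu, hrA', b', θ', e', U', E', hb'la, hb'mu, hθ'i la hlu hlf, hθ'i mu hmu hmf, he' la hlu hlf, he' mu hmu hmf, hu0', hf0',
    hdet', hU', hE', hrel', hoBp, hrBp, hdivBp, hisoBp, he3Bp⟩

/-! ## §2 Rotation case -/

/-- **TRANSPORT CORE — ROTATION CASE** (regime-free; the virtual translation `b′` off the slots is RETURNED). [OURS]
[cite: Hauser2010, §§F–G] [cite: CossartJannsenSaito2020, Thm. 3.14] -/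
theorem virtual_core_rotate {π : Equiv.Perm (Fin 4)} {a a' u f g gt : Fin 4} (haa' : a ≠ a') (hau : a ≠ u) (haf : a ≠ f)
    (ha'u : a' ≠ u) (ha'f : a' ≠ f) (huf : u ≠ f) (hg : (g = u ∧ gt = f) ∨ (g = f ∧ gt = u))
    -- the relation at precision `M`
    {A B : State K} {θ e : Fin 4 → MvPolynomial (Fin 4) K} {U E : MvPolynomial (Fin 4) K} {M : ℕ}
    (hθa : θ (π a) = X a * e a) (hθa' : θ (π a') = X a' * e a') (hea : constantCoeff (e a) ≠ 0)
    (hea' : constantCoeff (e a') ≠ 0) (hu0 : constantCoeff (θ (π u)) = 0) (hf0 : constantCoeff (θ (π f)) = 0)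
    (hdet : coeff (Finsupp.single u 1) (θ (π u)) * coeff (Finsupp.single f 1) (θ (π f)) -
      coeff (Finsupp.single f 1) (θ (π u)) * coeff (Finsupp.single u 1) (θ (π f)) ≠ 0)
    (hU : constantCoeff U ≠ 0) (hE : E ∈ originIdeal K ^ M) (hrel : B.F = deletePthPowers 5 (U ^ 5 * aeval θ A.F) + E)
    -- the real state and its honest rotation step
    (hoA : ordZero A.F = 6) {A' : State K} {b : Fin 4 → K} (hbj : b (π g) = 0) (hba : b (π a) ≠ 0) (hba' : b (π a') = 0)
    (hstep : A' = CentreBlowup.step 5 Finset.univ (π g) b A)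
    (hisoA' : IsIsolated 5 A'.F) {Nc : ℕ} (hcert : originIdeal K ^ Nc ≤ singLocusIdeal 5 A'.F ⊔ originIdeal K ^ (Nc + 1))
    (hoA' : ordZero A'.F = 6) {eG : ℕ} (he3A' : Module.finrank K (ResCone.resVertex A') = eG)
    (hrA' : A'.r = Finsupp.single (π g) 1 + Finsupp.single (π a') 1) (hdivA' : ∀ d ∈ A'.F.support, A'.r ≤ d)
    -- the virtual frame at jet `N`
    (hoB : ordZero B.F = 6) (hrB : B.r = Finsupp.single a 1 + Finsupp.single a' 1) (hdivB : ∀ d ∈ B.F.support, B.r ≤ d)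
    (hM : Nc + 12 ≤ M)
    -- `e_G` through the relation, BY VALUE (res-dim4-p-7 g4)
    (hEG : ∀ (π₁ : Equiv.Perm (Fin 4)) (A₁ B₁ : State K) (θ₁ e₁ : Fin 4 → MvPolynomial (Fin 4) K)
      (U₁ E₁ : MvPolynomial (Fin 4) K) (M₁ : ℕ),
      θ₁ (π₁ a) = X a * e₁ a → θ₁ (π₁ a') = X a' * e₁ a' → constantCoeff (e₁ a) ≠ 0 → constantCoeff (e₁ a') ≠ 0 →
      constantCoeff (θ₁ (π₁ u)) = 0 → constantCoeff (θ₁ (π₁ f)) = 0 →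
      coeff (Finsupp.single u 1) (θ₁ (π₁ u)) * coeff (Finsupp.single f 1) (θ₁ (π₁ f)) -
        coeff (Finsupp.single f 1) (θ₁ (π₁ u)) * coeff (Finsupp.single u 1) (θ₁ (π₁ f)) ≠ 0 →
      constantCoeff U₁ ≠ 0 → E₁ ∈ originIdeal K ^ M₁ → B₁.F = deletePthPowers 5 (U₁ ^ 5 * aeval θ₁ A₁.F) + E₁ →
      A₁.r = Finsupp.single (π₁ a) 1 + Finsupp.single (π₁ a') 1 → B₁.r = Finsupp.single a 1 + Finsupp.single a' 1 →
      (∀ d ∈ A₁.F.support, A₁.r ≤ d) → (∀ d ∈ B₁.F.support, B₁.r ≤ d) → ordZero A₁.F = 6 → ordZero B₁.F = 6 → 6 < M₁ →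
      Module.finrank K (ResCone.resVertex B₁) = Module.finrank K (ResCone.resVertex A₁)) :
    ∃ (π' : Equiv.Perm (Fin 4)) (b' : Fin 4 → K) (θ' e' : Fin 4 → MvPolynomial (Fin 4) K) (U' E' : MvPolynomial (Fin 4) K),
      π' = (Equiv.swap a g).trans π ∧ π' a = π g ∧ π' a' = π a' ∧ π' g = π a ∧ π' gt = π gt ∧ b' a = 0 ∧ b' a' = 0 ∧
      θ' (π' a) = X a * e' a ∧ θ' (π' a') = X a' * e' a' ∧ constantCoeff (e' a) ≠ 0 ∧ constantCoeff (e' a') ≠ 0 ∧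
      constantCoeff (θ' (π' u)) = 0 ∧ constantCoeff (θ' (π' f)) = 0 ∧
      coeff (Finsupp.single u 1) (θ' (π' u)) * coeff (Finsupp.single f 1) (θ' (π' f)) -
        coeff (Finsupp.single f 1) (θ' (π' u)) * coeff (Finsupp.single u 1) (θ' (π' f)) ≠ 0 ∧
      constantCoeff U' ≠ 0 ∧ E' ∈ originIdeal K ^ (M - 5) ∧
      (CentreBlowup.step 5 Finset.univ a b' B).F = deletePthPowers 5 (U' ^ 5 * aeval θ' A'.F) + E' ∧
      ordZero (CentreBlowup.step 5 Finset.univ a b' B).F = 6 ∧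
      (CentreBlowup.step 5 Finset.univ a b' B).r = Finsupp.single a 1 + Finsupp.single a' 1 ∧
      (∀ d ∈ (CentreBlowup.step 5 Finset.univ a b' B).F.support, (CentreBlowup.step 5 Finset.univ a b' B).r ≤ d) ∧
      IsIsolated 5 (CentreBlowup.step 5 Finset.univ a b' B).F ∧
      Module.finrank K (ResCone.resVertex (CentreBlowup.step 5 Finset.univ a b' B)) = eG := by
  haveI : Fact (Nat.Prime 5) := ⟨by norm_num⟩
  -- (1) the free letters `g, g̃`
  have hag : a ≠ g := by rcases hg with ⟨rfl, -⟩ | ⟨rfl, -⟩ <;> assumption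
  have hagt : a ≠ gt := by rcases hg with ⟨-, rfl⟩ | ⟨-, rfl⟩ <;> assumption
  have ha'g : a' ≠ g := by rcases hg with ⟨rfl, -⟩ | ⟨rfl, -⟩ <;> assumption
  have ha'gt : a' ≠ gt := by rcases hg with ⟨-, rfl⟩ | ⟨-, rfl⟩ <;> assumption
  have hggt : g ≠ gt := by
    rcases hg with ⟨rfl, rfl⟩ | ⟨rfl, rfl⟩
    · exact huf
    · exact huf.symm
  have hg0 : constantCoeff (θ (π g)) = 0 := by rcases hg with ⟨rfl, -⟩ | ⟨rfl, -⟩ <;> assumption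
  have hgt0 : constantCoeff (θ (π gt)) = 0 := by rcases hg with ⟨-, rfl⟩ | ⟨-, rfl⟩ <;> assumption
  have hdetg : coeff (Finsupp.single g 1) (θ (π g)) * coeff (Finsupp.single gt 1) (θ (π gt)) -
      coeff (Finsupp.single gt 1) (θ (π g)) * coeff (Finsupp.single g 1) (θ (π gt)) ≠ 0 := by
    rcases hg with ⟨rfl, rfl⟩ | ⟨rfl, rfl⟩
    · exact hdet
    · exact fun h => hdet (by linear_combination h)
  have hA5 : ((5 : ℕ) : ℕ∞) ≤ ordAlong Finset.univ A.F := by rw [ordAlong_univ, hoA]; exact_mod_cast (by norm_num : 5 ≤ 6)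
  have hB5 : ((5 : ℕ) : ℕ∞) ≤ ordAlong Finset.univ B.F := by rw [ordAlong_univ, hoB]; exact_mod_cast (by norm_num : 5 ≤ 6)
  -- (2) Cramer: the virtual translation and the rescaling `λ`
  obtain ⟨lam, b', hb'a, hb'a', hLa, hLg, hLgt⟩ :=
    exists_virtual_translation_rotate (π := π) (θ := θ) (e := e) hag hagt ha'g ha'gt hggt b hba hdetg
  have hlam : lam ≠ 0 := by
    intro h; rw [h, zero_mul] at hLa; exact hea hLa.symm
  -- (3) transport across the two charts
  obtain ⟨θ', e', U', E', hθ'g, hθ'a', he'a, he'a', ha0', hgt0', hU', hE', hrel', -, -, htana, htangt⟩ :=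
    unitFrame_rotate₂ 5 π haa' hag hagt ha'g ha'gt hggt (M := M) (by omega) hθa hθa' hea hea' hg0 hgt0 hU hE hrel hA5 hB5
      hbj hba' hb'a hb'a' hLa hLg hLgt
  rw [← hstep] at hrel'
  -- (4) the new free block is invertible
  have hD'g : coeff (Finsupp.single g 1) (θ' (π a)) * coeff (Finsupp.single gt 1) (θ' (π gt)) -
      coeff (Finsupp.single gt 1) (θ' (π a)) * coeff (Finsupp.single g 1) (θ' (π gt)) ≠ 0 := by
    intro h0
    have h := det_after_rotate hag hagt (σ := b (π gt)) hlam htana htangt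
    rw [h0, mul_zero] at h
    exact mul_ne_zero hea hdetg (neg_eq_zero.mp h.symm)
  -- (5) the new bijection `π′ = π ∘ (a g)`
  obtain ⟨π', hπ'⟩ : ∃ π' : Equiv.Perm (Fin 4), π' = (Equiv.swap a g).trans π := ⟨_, rfl⟩
  have hπ'a : π' a = π g := by rw [hπ', Equiv.trans_apply, Equiv.swap_apply_left]
  have hπ'g : π' g = π a := by rw [hπ', Equiv.trans_apply, Equiv.swap_apply_right]
  have hπ'a' : π' a' = π a' := by rw [hπ', Equiv.trans_apply, Equiv.swap_apply_of_ne_of_ne haa'.symm ha'g]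
  have hπ'gt : π' gt = π gt := by rw [hπ', Equiv.trans_apply, Equiv.swap_apply_of_ne_of_ne hagt.symm hggt.symm]
  have hθn : θ' (π' a) = X a * e' a := by rw [hπ'a]; exact hθ'g
  have hθn' : θ' (π' a') = X a' * e' a' := by rw [hπ'a']; exact hθ'a'
  have hu0n : constantCoeff (θ' (π' u)) = 0 := by
    rcases hg with ⟨rfl, rfl⟩ | ⟨rfl, rfl⟩
    · rw [hπ'g]; exact ha0'
    · rw [hπ'gt]; exact hgt0'
  have hf0n : constantCoeff (θ' (π' f)) = 0 := by
    rcases hg with ⟨rfl, rfl⟩ | ⟨rfl, rfl⟩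
    · rw [hπ'gt]; exact hgt0'
    · rw [hπ'g]; exact ha0'
  have hdetn : coeff (Finsupp.single u 1) (θ' (π' u)) * coeff (Finsupp.single f 1) (θ' (π' f)) -
      coeff (Finsupp.single f 1) (θ' (π' u)) * coeff (Finsupp.single u 1) (θ' (π' f)) ≠ 0 := by
    rcases hg with ⟨rfl, rfl⟩ | ⟨rfl, rfl⟩
    · rw [hπ'g, hπ'gt]; exact hD'g
    · rw [hπ'g, hπ'gt]; exact fun h => hD'g (by linear_combination h)
  have hrAn : A'.r = Finsupp.single (π' a) 1 + Finsupp.single (π' a') 1 := by rw [hπ'a, hπ'a']; exact hrA'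
  -- (6) order and isolation of the virtual child
  set Bp := CentreBlowup.step 5 Finset.univ a b' B with hBp
  have hread := read_of_rel₂ 5 haa' hau haf ha'u ha'f huf hθn hθn' he'a he'a' hu0n hf0n hdetn hU' hE' hrel' hisoA' hcert
    (by omega) (o := 6) hoA' (by norm_num) (by omega)
  have hisoBp : IsIsolated 5 Bp.F := hread.1
  have hoBp : ordZero Bp.F = 6 := by exact_mod_cast hread.2
  -- (7) ledger and divisibility of the virtual child, then `e_G` by value
  have hrBp : Bp.r = Finsupp.single a 1 + Finsupp.single a' 1 := by
    obtain ⟨-, h2, h3, h4⟩ := ResCone.quad_apply haa' hau haf ha'u ha'f huf 1 1 0 0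
    have hrB4 : B.r = Finsupp.single a 1 + Finsupp.single a' 1 + Finsupp.single u 0 + Finsupp.single f 0 := by
      rw [hrB, Finsupp.single_zero, Finsupp.single_zero, add_zero, add_zero]
    rw [ResCone.eq_sum_single_four haa' hau haf ha'u ha'f huf Bp.r, hBp, step_r_apply_six hoB, step_r_apply_six hoB,
      step_r_apply_six hoB, step_r_apply_six hoB, if_pos rfl, if_neg haa'.symm, if_pos hb'a', if_neg (Ne.symm hau),
      if_neg (Ne.symm haf), hrB4, h2, h3, h4, ite_self, ite_self, Finsupp.single_zero, Finsupp.single_zero, add_zero, add_zero]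
  have hdivBp : ∀ d ∈ Bp.F.support, Bp.r ≤ d := forall_le_step_six hoB hdivB a hb'a
  have he3Bp : Module.finrank K (ResCone.resVertex Bp) = eG := by
    rw [hEG π' A' Bp θ' e' U' E' (M - 5) hθn hθn' he'a he'a' hu0n hf0n hdetn hU' hE' hrel' hrAn hrBp hdivA' hdivBp hoA'
      hoBp (by omega)]
    exact he3A'
  exact ⟨π', b', θ', e', U', E', hπ', hπ'a, hπ'a', hπ'g, hπ'gt, hb'a, hb'a', hθn, hθn', he'a, he'a', hu0n, hf0n, hdetn, hU',
    hE', hrel', hoBp, hrBp, hdivBp, hisoBp, he3Bp⟩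

end SwapTransport

end Summit.ResolutionOfSingularities.ResolutionOfSingularities.Theorems.PIDim4

end
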